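import Literature.Computability.Complexity.PCP
import Literature.Computability.Complexity.RandomizedProofs
import Literature.Computability.Complexity.BranchingFn
import HarnessLib

/-!
# Probabilistically checkable proofs: `P ⊆ PCP(0, 0)` (proofs; trunk CplxCore)

Sibling proof file of `PCP.lean` (D-0014). Discharges its named fact `P_subset_PCP_zero`:
a polynomial-time decidable language has a nonadaptive PCP verifier using no coins and no
queries — the verifier ignores the proof and the (empty) coin string and decides the input
itself. This is the trivial half of Arora–Barak's Exercise 11.6 (`PCP(0, log n) = P`), and is
immediate from Def. 11.4: with `r = q = 0` the acceptance probability `Pr_ρ[V^π(x) = 1]` over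
the single coin string `ρ = []` is the indicator of `x ∈ L`, so completeness holds with
probability `1` and soundness with probability `0 ≤ 1/2`.

In the vendored model (`PCPVerifier.IsPolyTime`) the only content is machine-level: the query
map `(x, ρ) ↦ []` must be polynomial time on the pair presentation `boolPair x ρ` (a constant
string function, `const_mem_FP` of `BranchingFn.lean`, transported along the encoder), and the
decision map `(x, ρ, a) ↦ [x ∈ L]` must be polynomial time on the triple presentation
`boolPair x (boolPair ρ a)` — the composite (`PolyTimeComputable.comp_holds`,
`TimeBoundsProofs.lean`) of the first pair projection (`polyTimeComputable_fst_boolPair`,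
`RandomizedProofs.lean` / `PairProjections.lean`) with the given polynomial-time decider
(`mem_P_iff_holds`, `Classes.lean`).

## References

* S. Arora, B. Barak, *Computational Complexity: A Modern Approach*, CUP 2009, Def. 11.4
  (PCP verifier, p. 243) and Exercise 11.6 (`PCP(0, log n) = P`, Ch. 11 exercises).
* S. Arora, S. Safra, *Probabilistic checking of proofs: a new characterization of NP*,
  J. ACM 45 (1998), Def. 2.1–2.2.
-/

namespace Literature.Computability.Complexity

open _root_.Computability

variable {α β : Type}

/-- **Constant maps are polynomial-time computable, for any encoders.** If the output does
not depend on the input, the word map `ea a ↦ eb b` is the constant string function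
`z ↦ eb b`, which is in `FP` (`const_mem_FP`: a transducer discarding its input); transport
along the input encoder (`PolyTimeComputable.of_encode_eq`).
[Arora–Barak 2009, §1.3 (machine constructions)] [cite: AroraBarakCC2009, §1.3] -/
theorem PolyTimeComputable.const (ea : α → List Bool) (eb : β → List Bool) (b : β) :
    PolyTimeComputable ea eb (fun _ : α => b) :=
  PolyTimeComputable.of_encode_eq (f := fun _ : List Bool => eb b) (ea := id) (eb := id) ea
    (fun _ => rfl) (fun _ => rfl) (const_mem_FP (eb b))

/-- **First projection under the triple presentation `(x, ρ, a) ↦ ⟨x, ⟨ρ, a⟩⟩`.** The map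
`(x, ρ, a) ↦ x` is polynomial-time computable when the triple is presented as
`boolPair x (boolPair ρ a)` (the presentation of `PCPVerifier.IsPolyTime`): transport of the
pair projection `polyTimeComputable_fst_boolPair id` along `(x, ρ, a) ↦ (x, boolPair ρ a)`.
[Arora–Barak 2009, §0.1 (pairing), §1.2] [cite: AroraBarakCC2009, §0.1] -/
theorem polyTimeComputable_fst_boolPair_triple :
    PolyTimeComputable
      (fun p : List Bool × List Bool × List Bool => boolPair p.1 (boolPair p.2.1 p.2.2))
      (id : List Bool → List Bool) (fun p => p.1) :=
  PolyTimeComputable.of_encode_eq (f := (Prod.fst : List Bool × List Bool → List Bool))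
    (fun p : List Bool × List Bool × List Bool => (p.1, boolPair p.2.1 p.2.2))
    (fun _ => rfl) (fun _ => rfl) (polyTimeComputable_fst_boolPair id)

/-- **Discharge of `P_subset_PCP_zero`: `P ⊆ PCP(0, 0)`.** Given `L ∈ P`, the verifier
`V = ⟨coins := 0, queries := (x, ρ) ↦ [], decide := (x, ρ, a) ↦ [x ∈ L]⟩` uses `0 ≤ 0` coins
and `0 ≤ 0` queries; its query map is a constant (`PolyTimeComputable.const`) and its decision
map is the polynomial-time decider of `L` (`mem_P_iff_holds`) composed with the first
projection of the triple (`PolyTimeComputable.comp_holds`,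
`polyTimeComputable_fst_boolPair_triple`); for `x ∈ L` every coin string accepts
(`uniformProb_univ`: probability `1`), for `x ∉ L` none does (`uniformProb_empty`:
probability `0 ≤ 1/2`). This is the containment `P ⊆ PCP(0, q)` of Arora–Barak's
Exercise 11.6 (`PCP(0, log n) = P`) at `q = 0`, immediate from Def. 11.4.
[Arora–Barak 2009, Def. 11.4 (p. 243) and Exercise 11.6]
[cite: AroraBarakCC2009, Def. 11.4 and Exercise 11.6] -/
theorem P_subset_PCP_zero_holds : P_subset_PCP_zero := by
  intro L hL
  have hdec : PolyTimeComputable id encodeBool L.boolIndicator :=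
    polyTimeDecidable_iff.1 (mem_P_iff_holds.1 hL)
  refine ⟨⟨fun _ => 0, fun _ _ => [], fun x _ _ => L.boolIndicator x⟩,
    ⟨PolyTimeComputable.const _ _ [], ?_, 0, fun _ => Nat.zero_le _⟩,
    fun _ => Nat.zero_le _, fun _ _ => Nat.zero_le _, fun x hx => ⟨fun _ => false, ?_⟩,
    fun x hx π => ?_⟩
  · -- the decision map `(x, ρ, a) ↦ [x ∈ L]` is `L.boolIndicator ∘ Prod.fst`
    exact PolyTimeComputable.comp_holds hdec polyTimeComputable_fst_boolPair_triple
  · -- completeness: every coin string accepts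
    have hx' : L.boolIndicator x = true := (Set.mem_iff_boolIndicator L x).1 hx
    simp [PCPVerifier.acceptProb, PCPVerifier.accepts, hx']
  · -- soundness: no coin string accepts
    have hx' : L.boolIndicator x = false := (Set.notMem_iff_boolIndicator L x).1 hx
    norm_num [PCPVerifier.acceptProb, PCPVerifier.accepts, hx']

end Literature.Computability.Complexity
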